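import Mathlib

/-!
# `MatrixDescartes` census — the LORENTZ ROWS (P, T) of the cell's LP certificates as kernel lemmas

HONEST FRAMING.  Object-search cell `pub-symmetroid`, route crux `Theses.LacunarySymmetroid.MatrixDescartes`
(ledger item stmt-ValiantsHypothesis-18050).  The cell's magnitude-level support certificates at `m = 2`
(T-NC-LP-CERT, theory g4; third check referee g18 TNC-REF-g18.md; «ζ_sym(2,6; 0,9,11,12,17,N) ≤ 19» on the four
record supports, three codes) are exact LP refutations whose ROWS are: N = C25 Newton cone (kernel:
`…CensusNewtonCone.lean`), L3 = forced letters (kernel: `…CensusFullAlternation.lean` + the dictionary of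
`…CensusSignClass.lean`), and the two LORENTZ families typed here, in entry coordinates `Sₗ = [[aₗ,bₗ],[bₗ,cₗ]]`,
`qₗ = det Sₗ`, `βₗₘ = aₗcₘ + cₗaₘ − 2bₗbₘ = 2B(Sₗ,Sₘ)` (= the coefficients of `det F` at `2dₗ`, `dₗ + dₘ` on uncollided
exponents):

* P rows (L4, reverse Cauchy–Schwarz in signature `(1,2)`): `four_det_mul_det_le_polarDet_sq` — `q_i > 0 ⇒
  4 q_i q_j ≤ β_ij²` (for definite `i, j` this is `|ρ_ij| ≥ 1`, i.e. `x_ij ≥ 0`);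
* T rows (L5, Gram determinant through a definite letter `j`): the identities `gram_three_eq_sq` (the `B`-Gram
  determinant of three letters is `det(N)² ≥ 0`) and `gram_master_identity`
  (`(2q_jβ_ik − β_ijβ_jk)² + 4q_j det(N)² = Δ_ij Δ_jk`, `Δ = β² − 4qq`), and the three branch forms the LP uses
  (`x_ik ≤ 3 log 2 + x⁺_ij + x⁺_jk`): `trow_long_long` (`|β_ik| q_j ≤ 4|β_ij||β_jk|`), `trow_short_long` /
  `trow_long_short` (`β_ik² q_j ≤ 64 β_jk² |q_i|`, resp. `64 β_ij² |q_k|`), `trow_short_short` (`β_ik² ≤ 256|q_i||q_k|`),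
  stated abstractly from the master identity so that a certificate file instantiates them with
  `gram_master_identity`.

With these, every row family of the T-NC certificate is a kernel theorem; what is NOT here is the per-node Farkas
arithmetic (layer A: `Σ yα = 0`, `Σ yβ < 0`, checked three times in exact arithmetic outside the kernel) and hence
no bound on any `ζ(2,6;d)` is claimed in this file.  Nothing bears on the crux `MatrixDescartes` or `VP ≠ VNP`.

[folklore] Elementary algebra of `2 × 2` symmetric matrices (`Sym₂(ℝ)` with `det` is Minkowski space `ℝ^{1,2}`).
-/

-- `Summit.ValiantsHypothesis.ValiantsHypothesis.…` repeats a component by the D-0017 layout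
-- (single-conjunct summit), which the `dupNamespace` linter flags; the name is mandated.
set_option linter.dupNamespace false

namespace Summit.ValiantsHypothesis.ValiantsHypothesis.Theorems.LacunarySymmetroidMatrixDescartes.Census

/-- **P row (reverse Cauchy–Schwarz in `Sym₂(ℝ)`, signature `(1,2)`).**  For a DEFINITE real symmetric
`S = [[a,b],[b,c]]` (`ac − b² > 0`) and ANY symmetric `T = [[a',b'],[b',c']]`:
`4·det S·det T ≤ (2B(S,T))²`, `2B(S,T) = ac' + ca' − 2bb'` — the pencil `det(tS + T)` has real roots.
Identity used: `a²((2B)² − 4 det S det T) = (a·2B − 2 det S·a')² + 4 det S (ab' − a'b)²`. [folklore] -/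
theorem four_det_mul_det_le_polarDet_sq (a b c a' b' c' : ℝ) (hS : 0 < a * c - b ^ 2) :
    4 * (a * c - b ^ 2) * (a' * c' - b' ^ 2) ≤ (a * c' + c * a' - 2 * (b * b')) ^ 2 := by
  have ha : a ≠ 0 := by rintro rfl; nlinarith [sq_nonneg b]
  have ha2 : 0 < a ^ 2 := by positivity
  have key : a ^ 2 * ((a * c' + c * a' - 2 * (b * b')) ^ 2 - 4 * (a * c - b ^ 2) * (a' * c' - b' ^ 2))
      = (a * (a * c' + c * a' - 2 * (b * b')) - 2 * (a * c - b ^ 2) * a') ^ 2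
        + 4 * (a * c - b ^ 2) * (a * b' - a' * b) ^ 2 := by ring
  have hnn : 0 ≤ a ^ 2 * ((a * c' + c * a' - 2 * (b * b')) ^ 2 - 4 * (a * c - b ^ 2) * (a' * c' - b' ^ 2)) := by
    rw [key]; positivity
  nlinarith [hnn, ha2, (mul_nonneg_iff_of_pos_left ha2).mp hnn]

/-- **Gram identity in `Sym₂(ℝ)`.**  For three real symmetric `2 × 2` matrices with `qₗ = det Sₗ` and
`βₗₘ = 2B(Sₗ,Sₘ)`: `4 q_i q_j q_k + β_ij β_jk β_ik − q_i β_jk² − q_j β_ik² − q_k β_ij² = det(N)²`, `N` the `3 × 3`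
matrix of entries `(aₗ, bₗ, cₗ)` — the Gram determinant of three vectors for a form of signature `(1,2)` is a
square, in particular `≥ 0` (row family «T» of T-NC-LP-CERT, L5). [folklore] -/
theorem gram_three_eq_sq (a b c a' b' c' a'' b'' c'' : ℝ) :
    4 * (a * c - b ^ 2) * (a' * c' - b' ^ 2) * (a'' * c'' - b'' ^ 2)
      + (a * c' + c * a' - 2 * (b * b')) * (a' * c'' + c' * a'' - 2 * (b' * b'')) *
          (a * c'' + c * a'' - 2 * (b * b''))
      - (a * c - b ^ 2) * (a' * c'' + c' * a'' - 2 * (b' * b'')) ^ 2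
      - (a' * c' - b' ^ 2) * (a * c'' + c * a'' - 2 * (b * b'')) ^ 2
      - (a'' * c'' - b'' ^ 2) * (a * c' + c * a' - 2 * (b * b')) ^ 2
    = (a * (b' * c'' - c' * b'') - b * (a' * c'' - c' * a'') + c * (a' * b'' - b' * a'')) ^ 2 := by
  ring

/-- **Master identity behind the T rows.**  With `Δₗₘ := βₗₘ² − 4 qₗ qₘ`:
`(2 q_j β_ik − β_ij β_jk)² + 4 q_j det(N)² = Δ_ij Δ_jk` — so for a definite middle letter `j` (`q_j > 0`),
`|2 q_j β_ik − β_ij β_jk| ≤ √(Δ_ij Δ_jk)` (the exact Gram bound of L5). [folklore] -/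
theorem gram_master_identity (a b c a' b' c' a'' b'' c'' : ℝ) :
    (2 * (a' * c' - b' ^ 2) * (a * c'' + c * a'' - 2 * (b * b''))
        - (a * c' + c * a' - 2 * (b * b')) * (a' * c'' + c' * a'' - 2 * (b' * b''))) ^ 2
      + 4 * (a' * c' - b' ^ 2) *
          (a * (b' * c'' - c' * b'') - b * (a' * c'' - c' * a'') + c * (a' * b'' - b' * a'')) ^ 2
    = ((a * c' + c * a' - 2 * (b * b')) ^ 2 - 4 * (a * c - b ^ 2) * (a' * c' - b' ^ 2))
      * ((a' * c'' + c' * a'' - 2 * (b' * b'')) ^ 2 - 4 * (a' * c' - b' ^ 2) * (a'' * c'' - b'' ^ 2)) := by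
  ring

/-- T row, abstract form, both legs LONG (`|ρ_ij|, |ρ_jk| ≥ 1`): from the master identity with `q_j > 0`,
`4|q_i|q_j ≤ β_ij²` and `4 q_j|q_k| ≤ β_jk²` it follows that `|β_ik|·q_j ≤ 4·|β_ij|·|β_jk|`
(indeed `≤ 3/2 ·`; the LP uses the constant of `|ρ_ik| ≤ 8|ρ_ij||ρ_jk|`). [folklore] -/
theorem trow_long_long {qi qj qk bij bjk bik D : ℝ}
    (hM : (2 * qj * bik - bij * bjk) ^ 2 + 4 * qj * D ^ 2 = (bij ^ 2 - 4 * qi * qj) * (bjk ^ 2 - 4 * qj * qk))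
    (hqj : 0 < qj) (h1 : 4 * |qi| * qj ≤ bij ^ 2) (h2 : 4 * qj * |qk| ≤ bjk ^ 2) :
    |bik| * qj ≤ 4 * |bij| * |bjk| := by
  have hqi : qi ≤ |qi| := le_abs_self qi
  have hqi' : -|qi| ≤ qi := neg_abs_le qi
  have hqk : qk ≤ |qk| := le_abs_self qk
  have hqk' : -|qk| ≤ qk := neg_abs_le qk
  have hDij0 : 0 ≤ bij ^ 2 - 4 * qi * qj := by nlinarith
  have hDij1 : bij ^ 2 - 4 * qi * qj ≤ 2 * bij ^ 2 := by nlinarith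
  have hDjk0 : 0 ≤ bjk ^ 2 - 4 * qj * qk := by nlinarith
  have hDjk1 : bjk ^ 2 - 4 * qj * qk ≤ 2 * bjk ^ 2 := by nlinarith
  have hsq : (2 * qj * bik - bij * bjk) ^ 2 ≤ (2 * (bij * bjk)) ^ 2 := by
    have h4 : 0 ≤ 4 * qj * D ^ 2 := by positivity
    nlinarith [mul_le_mul hDij1 hDjk1 hDjk0 (by positivity)]
  have habs : |2 * qj * bik - bij * bjk| ≤ |2 * (bij * bjk)| := sq_le_sq.mp hsq
  have htri : |2 * qj * bik| ≤ |2 * qj * bik - bij * bjk| + |bij * bjk| := by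
    have := abs_add_le (2 * qj * bik - bij * bjk) (bij * bjk)
    rwa [sub_add_cancel] at this
  have e1 : |2 * qj * bik| = 2 * qj * |bik| := by
    rw [abs_mul, abs_mul, abs_two, abs_of_pos hqj]
  have e2 : |2 * (bij * bjk)| = 2 * (|bij| * |bjk|) := by
    rw [abs_mul, abs_mul, abs_two]
  have e3 : |bij * bjk| = |bij| * |bjk| := abs_mul _ _
  rw [e1, e3] at htri
  rw [e2] at habs
  nlinarith [abs_nonneg bij, abs_nonneg bjk, abs_nonneg bik]

/-- T row, abstract form, leg `ij` SHORT (`|ρ_ij| ≤ 1`) and leg `jk` LONG: `β_ik²·q_j ≤ 64·β_jk²·|q_i|`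
(indeed `≤ 10·`). [folklore] -/
theorem trow_short_long {qi qj qk bij bjk bik D : ℝ}
    (hM : (2 * qj * bik - bij * bjk) ^ 2 + 4 * qj * D ^ 2 = (bij ^ 2 - 4 * qi * qj) * (bjk ^ 2 - 4 * qj * qk))
    (hqj : 0 < qj) (h1 : bij ^ 2 ≤ 4 * |qi| * qj) (h2 : 4 * qj * |qk| ≤ bjk ^ 2) :
    bik ^ 2 * qj ≤ 64 * bjk ^ 2 * |qi| := by
  have hqi : qi ≤ |qi| := le_abs_self qi
  have hqi' : -|qi| ≤ qi := neg_abs_le qi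
  have hqk : qk ≤ |qk| := le_abs_self qk
  have hqk' : -|qk| ≤ qk := neg_abs_le qk
  have hqia : 0 ≤ |qi| := abs_nonneg qi
  -- |Δ_ij| ≤ 8|q_i|q_j,  0 ≤ Δ_jk ≤ 2 β_jk²
  have hDij1 : bij ^ 2 - 4 * qi * qj ≤ 8 * |qi| * qj := by nlinarith
  have hDij2 : -(8 * |qi| * qj) ≤ bij ^ 2 - 4 * qi * qj := by nlinarith
  have hDjk0 : 0 ≤ bjk ^ 2 - 4 * qj * qk := by nlinarith
  have hDjk1 : bjk ^ 2 - 4 * qj * qk ≤ 2 * bjk ^ 2 := by nlinarith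
  have hprod : (bij ^ 2 - 4 * qi * qj) * (bjk ^ 2 - 4 * qj * qk) ≤ (8 * |qi| * qj) * (2 * bjk ^ 2) := by
    nlinarith [mul_le_mul_of_nonneg_right hDij1 hDjk0, mul_le_mul_of_nonneg_left hDjk1 (by positivity : 0 ≤ 8 * |qi| * qj)]
  have hsq : (2 * qj * bik - bij * bjk) ^ 2 ≤ 16 * |qi| * qj * bjk ^ 2 := by
    have h4 : 0 ≤ 4 * qj * D ^ 2 := by positivity
    nlinarith
  have hyy : (bij * bjk) ^ 2 ≤ 4 * |qi| * qj * bjk ^ 2 := by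
    rw [mul_pow]; nlinarith [sq_nonneg bjk]
  -- x² ≤ 2(x−y)² + 2y²
  have hx : (2 * qj * bik) ^ 2 ≤ 2 * (2 * qj * bik - bij * bjk) ^ 2 + 2 * (bij * bjk) ^ 2 := by
    nlinarith [sq_nonneg (2 * qj * bik - 2 * (bij * bjk))]
  have h40 : 4 * qj ^ 2 * bik ^ 2 ≤ 40 * |qi| * qj * bjk ^ 2 := by nlinarith
  have : qj * (bik ^ 2 * qj) ≤ qj * (64 * bjk ^ 2 * |qi|) := by nlinarith [sq_nonneg bjk, sq_nonneg bik]
  exact le_of_mul_le_mul_left this hqj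

/-- T row, abstract form, leg `ij` LONG and leg `jk` SHORT: `β_ik²·q_j ≤ 64·β_ij²·|q_k|`. [folklore] -/
theorem trow_long_short {qi qj qk bij bjk bik D : ℝ}
    (hM : (2 * qj * bik - bij * bjk) ^ 2 + 4 * qj * D ^ 2 = (bij ^ 2 - 4 * qi * qj) * (bjk ^ 2 - 4 * qj * qk))
    (hqj : 0 < qj) (h1 : 4 * |qi| * qj ≤ bij ^ 2) (h2 : bjk ^ 2 ≤ 4 * qj * |qk|) :
    bik ^ 2 * qj ≤ 64 * bij ^ 2 * |qk| := by
  have hqi : qi ≤ |qi| := le_abs_self qi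
  have hqi' : -|qi| ≤ qi := neg_abs_le qi
  have hqk : qk ≤ |qk| := le_abs_self qk
  have hqk' : -|qk| ≤ qk := neg_abs_le qk
  have hqka : 0 ≤ |qk| := abs_nonneg qk
  have hDjk1 : bjk ^ 2 - 4 * qj * qk ≤ 8 * qj * |qk| := by nlinarith
  have hDjk2 : -(8 * qj * |qk|) ≤ bjk ^ 2 - 4 * qj * qk := by nlinarith
  have hDij0 : 0 ≤ bij ^ 2 - 4 * qi * qj := by nlinarith
  have hDij1 : bij ^ 2 - 4 * qi * qj ≤ 2 * bij ^ 2 := by nlinarith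
  have hprod : (bij ^ 2 - 4 * qi * qj) * (bjk ^ 2 - 4 * qj * qk) ≤ (2 * bij ^ 2) * (8 * qj * |qk|) := by
    nlinarith [mul_le_mul_of_nonneg_left hDjk1 hDij0, mul_le_mul_of_nonneg_right hDij1 (by positivity : 0 ≤ 8 * qj * |qk|)]
  have hsq : (2 * qj * bik - bij * bjk) ^ 2 ≤ 16 * |qk| * qj * bij ^ 2 := by
    have h4 : 0 ≤ 4 * qj * D ^ 2 := by positivity
    nlinarith
  have hyy : (bij * bjk) ^ 2 ≤ 4 * qj * |qk| * bij ^ 2 := by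
    rw [mul_pow]; nlinarith [sq_nonneg bij]
  have hx : (2 * qj * bik) ^ 2 ≤ 2 * (2 * qj * bik - bij * bjk) ^ 2 + 2 * (bij * bjk) ^ 2 := by
    nlinarith [sq_nonneg (2 * qj * bik - 2 * (bij * bjk))]
  have h40 : 4 * qj ^ 2 * bik ^ 2 ≤ 40 * |qk| * qj * bij ^ 2 := by nlinarith
  have : qj * (bik ^ 2 * qj) ≤ qj * (64 * bij ^ 2 * |qk|) := by nlinarith [sq_nonneg bij, sq_nonneg bik]
  exact le_of_mul_le_mul_left this hqj

/-- T row, abstract form, both legs SHORT: `β_ik² ≤ 256·|q_i|·|q_k|` (indeed `≤ 40·`). [folklore] -/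
theorem trow_short_short {qi qj qk bij bjk bik D : ℝ}
    (hM : (2 * qj * bik - bij * bjk) ^ 2 + 4 * qj * D ^ 2 = (bij ^ 2 - 4 * qi * qj) * (bjk ^ 2 - 4 * qj * qk))
    (hqj : 0 < qj) (h1 : bij ^ 2 ≤ 4 * |qi| * qj) (h2 : bjk ^ 2 ≤ 4 * qj * |qk|) :
    bik ^ 2 ≤ 256 * |qi| * |qk| := by
  have hqi : qi ≤ |qi| := le_abs_self qi
  have hqi' : -|qi| ≤ qi := neg_abs_le qi
  have hqk : qk ≤ |qk| := le_abs_self qk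
  have hqk' : -|qk| ≤ qk := neg_abs_le qk
  have hqia : 0 ≤ |qi| := abs_nonneg qi
  have hqka : 0 ≤ |qk| := abs_nonneg qk
  have hDij1 : bij ^ 2 - 4 * qi * qj ≤ 8 * |qi| * qj := by nlinarith
  have hDij2 : -(8 * |qi| * qj) ≤ bij ^ 2 - 4 * qi * qj := by nlinarith
  have hDjk1 : bjk ^ 2 - 4 * qj * qk ≤ 8 * qj * |qk| := by nlinarith
  have hDjk2 : -(8 * qj * |qk|) ≤ bjk ^ 2 - 4 * qj * qk := by nlinarith
  have hprod : (bij ^ 2 - 4 * qi * qj) * (bjk ^ 2 - 4 * qj * qk) ≤ (8 * |qi| * qj) * (8 * qj * |qk|) := by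
    have ha : |bij ^ 2 - 4 * qi * qj| ≤ 8 * |qi| * qj := abs_le.mpr ⟨hDij2, hDij1⟩
    have hb : |bjk ^ 2 - 4 * qj * qk| ≤ 8 * qj * |qk| := abs_le.mpr ⟨hDjk2, hDjk1⟩
    calc (bij ^ 2 - 4 * qi * qj) * (bjk ^ 2 - 4 * qj * qk)
        ≤ |(bij ^ 2 - 4 * qi * qj) * (bjk ^ 2 - 4 * qj * qk)| := le_abs_self _
      _ = |bij ^ 2 - 4 * qi * qj| * |bjk ^ 2 - 4 * qj * qk| := abs_mul _ _
      _ ≤ (8 * |qi| * qj) * (8 * qj * |qk|) := mul_le_mul ha hb (abs_nonneg _) (by positivity)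
  have hsq : (2 * qj * bik - bij * bjk) ^ 2 ≤ 64 * |qi| * qj ^ 2 * |qk| := by
    have h4 : 0 ≤ 4 * qj * D ^ 2 := by positivity
    nlinarith
  have hyy : (bij * bjk) ^ 2 ≤ 16 * |qi| * qj ^ 2 * |qk| := by
    rw [mul_pow]
    calc bij ^ 2 * bjk ^ 2 ≤ (4 * |qi| * qj) * (4 * qj * |qk|) :=
          mul_le_mul h1 h2 (sq_nonneg _) (by positivity)
      _ = 16 * |qi| * qj ^ 2 * |qk| := by ring
  have hx : (2 * qj * bik) ^ 2 ≤ 2 * (2 * qj * bik - bij * bjk) ^ 2 + 2 * (bij * bjk) ^ 2 := by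
    nlinarith [sq_nonneg (2 * qj * bik - 2 * (bij * bjk))]
  have h160 : 4 * qj ^ 2 * bik ^ 2 ≤ 160 * |qi| * qj ^ 2 * |qk| := by nlinarith
  have hqj2 : 0 < qj ^ 2 := by positivity
  have : qj ^ 2 * bik ^ 2 ≤ qj ^ 2 * (256 * |qi| * |qk|) := by nlinarith
  exact le_of_mul_le_mul_left this hqj2

end Summit.ValiantsHypothesis.ValiantsHypothesis.Theorems.LacunarySymmetroidMatrixDescartes.Census
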